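/-
Copyright (c) 2026 the pub-hodgecm-mathlib formalisation cell (harness21).  Prover seat hodgecm-mathlib-K2E4-p09 (g0), Track B «K2-LIT» ∕ h413, ENGINE E4 unit U6 `ArchLimitConstant`:
the SIGNED twins of the #9 assembly's input structures (targets for #10♯ ∕ ‹W›, K2E4-p15 (g2) 22:42:28Z bytes).  2026-09-03.
-/
import Summits.HodgeConjecture.HodgeConjecture.Theorems.K2E4ExplicitArchSingularTransferDefs   -- ★ p855024 (this seat): `HStepData`, `GPrimeData`
import HarnessLib

/-!
# `K2E4ExplicitArchSingularTransferSignedDefs` — SIGNED twins of `HStepData` ∕ `GPrimeData` (the sign law behind #10♯ `sig_K2E4ExplicitArchConstantPhaseSigned`)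
# (Rogawski 1990 Prop. 8.2.1 proof p. 119 «the constant in the limit formula for H′ differs by a sign from that for H»; Lemma 14.5.2 (b) p. 238)

Track B ∕ K2-LIT, crux h413 = `stmt-HodgeConjecture-24833`; prover seat `hodgecm-mathlib-K2E4-p09` (g0), assembler of #9.  DEFINITIONS ONLY (two `structure`s extending ★ p855024's, each by ONE
sign field; no `Prop`-valued def, no instance, no notation, no `sorry`).  A NEW FILE rather than an edition of ★ `…Defs` so that nothing downstream of `…Defs` rebuilds tonight.
WHY.  ★ p855083 proves #9 with the VALUE `c_∞ = κ·(∏_w C_w)·2^{|W|} ∕ λ` (`κ > 0` from ★ (β₀), `C_w = HStepData.C`, `λ = GPrimeData.lam`); #10♯ (K2E4-p15 (g2), ★ p855349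
`explicitArchConstantPhaseSigned_of_signLaw`) needs the PHASE of `c_∞`, i.e. the sign of every `C_w` and the phase of `λ`.  K2E4-p15's bytes (K2 bus 22:42:28Z):
* **`HStepDataSigned … extends HStepData L νw z w₁`** + `C_neg : C < 0` (Harish-Chandra's constant `C = −2π·C₁(ν)`, `0 < C₁`, ★ (R1G) ∕ ★ `ArchRankOneOrbitChart`; target of K2E4-p13);
* **`GPrimeDataSigned … extends GPrimeData L α T′ ν e₁ e₂ h₁ h₂`** + `lam_phase : ∃ s : ℝ, 0 < s ∧ lam = s · (∏_w sgn Re σ_w(α₀α₂)) · T′.Δ(h₀, t)` with `t` = the wall torus point of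
  `end_eq` and `h₀` = the `H_∞`-point of `reg` at the CENTRAL 2-block datum `u = (σe₁, σe₁)` (frame-intrinsic: `α`, `T′`, `e₁`, `e₂` only; target of K2E4-p11).
The signed assembly `explicitArchSingularTransfer_of_packages_signed : hHs → hGs → hTr → ‹signed #9›` is the follow-on (this seat, after #9 ∕ #10 are ★).
HONEST LABEL: HC_CM is proved only modulo the 7 printed citations (2 remaining named inputs: hLiu418 = `stmt-HodgeConjecture-24832`, h413 = `stmt-HodgeConjecture-24833`) until rung 0
closes; these are definitions, they assert nothing.

## References
* [Rogawski1990] J. D. Rogawski, *Automorphic Representations of Unitary Groups in Three Variables*, Ann. of Math. Stud. 123 (1990): §8.2 Prop. 8.2.1 proof pp. 118–119; §14.5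
  Lemma 14.5.2 (b) pp. 238–239.
* [Varadarajan1989] V. S. Varadarajan, *An Introduction to Harmonic Analysis on Semisimple Lie Groups* (1989), §6.4 Thm 22.
-/

set_option autoImplicit false
-- the mandated namespace repeats the single-problem summit's segment (`HodgeConjecture.HodgeConjecture`)
set_option linter.dupNamespace false

noncomputable section

open MeasureTheory Measure NumberField NumberField.InfinitePlace NumberField.mixedEmbedding IsDedekindDomain Filter Topology Set
open Literature.MeasureTheory.Group
open Literature.NumberTheory.Rogawski1990 Literature.NumberTheory.Automorphic Literature.NumberTheory.GaloisRepresentations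
open Literature.AlgebraicGeometry.ShimuraVarieties (unitaryGroup hermForm)
-- `Classical`: the place subtypes indexing `mixedSpace L` are `Fintype` classically
open scoped Matrix MatrixGroups ComplexOrder ContDiff Classical
open scoped Matrix.Norms.Operator

namespace Summit.HodgeConjecture.HodgeConjecture.Cruxes.H413.K2E4ExplicitArchSingularTransferSignedDefs

open Summit.HodgeConjecture.HodgeConjecture.Cruxes.H413.K2E4ExplicitArchSingularTransferDefs (HStepData GPrimeData)

/-- **THE H-STEP LAW WITH ITS SIGN**: ★ `HStepData` and `C < 0` (Harish-Chandra's constant at the centre of the `U(1,1)`-type 2-block is `−2π·C₁(ν)` with `C₁ > 0`; ONE universal sign at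
every place). [cite: Rogawski1990, §8.2 Prop. 8.2.1 proof p. 119] [cite: Varadarajan1989, §6.4 Thm 22] -/
structure HStepDataSigned (L : Type) [Field L] [NumberField L] [IsCMField L]
    [∀ w : {w : InfinitePlace L // IsComplex w}, MeasurableSpace (UnitaryGroup.archLocal L 2 (Matrix.diagonal ![(2 : L)⁻¹, -(2 : L)⁻¹]) w)] [∀ w : {w : InfinitePlace L // IsComplex w}, BorelSpace (UnitaryGroup.archLocal L 2 (Matrix.diagonal ![(2 : L)⁻¹, -(2 : L)⁻¹]) w)]
    (νw : ∀ w : {w : InfinitePlace L // IsComplex w}, Measure (UnitaryGroup.archLocal L 2 (Matrix.diagonal ![(2 : L)⁻¹, -(2 : L)⁻¹]) w)) (z : {w : InfinitePlace L // IsComplex w} → Circle) (w₁ : {w : InfinitePlace L // IsComplex w}) : Type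
    extends HStepData L νw z w₁ where
  /-- Harish-Chandra's constant is negative. -/
  C_neg : C < 0

/-- **THE G′-PACKAGE WITH THE PHASE OF ITS END CONSTANT**: ★ `GPrimeData` and `lam = s · (∏_w sgn Re σ_w(α₀ α₂)) · T′.Δ(h₀, t)` for some `s > 0`, where `t = t(σe₁, σe₂, σe₁)` is the wall
torus point of `end_eq` and `h₀ = (Ψ_{Q₂}⁻¹ t₂(σe₁, σe₁), diag(σe₂))` the `H_∞`-point of `reg` at the central 2-block datum — print's «the constant in the limit formula for `H′` differs
by a sign from that for `H`», place by place, compensated by the sheet's `κ_w`. [cite: Rogawski1990, §8.2 Prop. 8.2.1 proof p. 119; §14.5 Lemma 14.5.2 (b) p. 238] -/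
structure GPrimeDataSigned (L : Type) [Field L] [NumberField L] [IsCMField L] (α : Fin 3 → L)
    [MeasurableSpace (UnitaryGroup.arch (↥(maximalRealSubfield L)) L (IsCMField.complexConj L) 3 (Matrix.diagonal α))] [BorelSpace (UnitaryGroup.arch (↥(maximalRealSubfield L)) L (IsCMField.complexConj L) 3 (Matrix.diagonal α))]
    [∀ γ : UnitaryGroup.arch (↥(maximalRealSubfield L)) L (IsCMField.complexConj L) 3 (Matrix.diagonal α), MeasurableSpace (UnitaryGroup.arch (↥(maximalRealSubfield L)) L (IsCMField.complexConj L) 3 (Matrix.diagonal α) ⧸ Subgroup.centralizer ({γ} : Set (UnitaryGroup.arch (↥(maximalRealSubfield L)) L (IsCMField.complexConj L) 3 (Matrix.diagonal α))))]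
    [∀ γ : UnitaryGroup.arch (↥(maximalRealSubfield L)) L (IsCMField.complexConj L) 3 (Matrix.diagonal α), BorelSpace (UnitaryGroup.arch (↥(maximalRealSubfield L)) L (IsCMField.complexConj L) 3 (Matrix.diagonal α) ⧸ Subgroup.centralizer ({γ} : Set (UnitaryGroup.arch (↥(maximalRealSubfield L)) L (IsCMField.complexConj L) 3 (Matrix.diagonal α))))]
    (T' : ArchTransferFactor L (Matrix.diagonal α)) (ν : Measure (UnitaryGroup.arch (↥(maximalRealSubfield L)) L (IsCMField.complexConj L) 3 (Matrix.diagonal α))) [IsFiniteMeasureOnCompacts ν] [ν.IsMulRightInvariant]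
    (e₁ e₂ : L) (h₁ : (IsCMField.complexConj L e₁ : L) * e₁ = 1) (h₂ : (IsCMField.complexConj L e₂ : L) * e₂ = 1) : Type
    extends GPrimeData L α T' ν e₁ e₂ h₁ h₂ where
  /-- The phase law of the end constant. -/
  lam_phase : ∃ s : ℝ, 0 < s ∧
    lam = (s : ℂ) * ((∏ w : {w : InfinitePlace L // IsComplex w}, (SignType.sign ((w.1.embedding (α 0 * α 2)).re) : ℤ)) : ℂ) *
      T'.Δ ((unitaryGroupOfFormCongrOfEq (UnitaryGroup.conjMixed (↥(maximalRealSubfield L)) L (IsCMField.complexConj L))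
              (Matrix.GeneralLinearGroup.map (mixedEmbedding L) (Matrix.GeneralLinearGroup.mkOfDetNeZero !![(1 : L), 1; 1, -1] (UnitaryGroup.det_quasiSplitFrameTwo_ne_zero L)))
              (UnitaryGroup.archFormOf L 2 (Matrix.diagonal ![(2 : L)⁻¹, -(2 : L)⁻¹])) (UnitaryGroup.archFormOf L 2 (Matrix.of fun i j : Fin 2 => if i.val + j.val + 1 = 2 then (1 : L) else 0))
              (UnitaryGroup.formCongr_map_mixedEmbedding_archFormOf_eq L (UnitaryGroup.formCongr_quasiSplitFrameTwo_diagonal L))).symm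
              (UnitaryGroup.archDiagTorus L 2 ![(2 : L)⁻¹, -(2 : L)⁻¹] fun w => ![(⟨w.1.embedding e₁, mem_sphere_zero_iff_norm.mpr (UnitaryGroup.norm_embedding_eq_one_of_complexConj_mul_self L e₁ h₁ w)⟩ : Circle), ⟨w.1.embedding e₁, mem_sphere_zero_iff_norm.mpr (UnitaryGroup.norm_embedding_eq_one_of_complexConj_mul_self L e₁ h₁ w)⟩]),
            (UnitaryGroup.archPiEquivCM 1 L (Matrix.of fun i j : Fin 1 => if i.val + j.val + 1 = 1 then (1 : L) else 0)).symm fun w =>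
              ⟨UnitaryGroup.circleDiagonal 1 ![(⟨w.1.embedding e₂, mem_sphere_zero_iff_norm.mpr (UnitaryGroup.norm_embedding_eq_one_of_complexConj_mul_self L e₂ h₂ w)⟩ : Circle)], UnitaryGroup.circleDiagonal_mem_archLocal_antidiagOne L w _⟩)
        (UnitaryGroup.archDiagTorus L 3 α fun w => ![(⟨w.1.embedding e₁, mem_sphere_zero_iff_norm.mpr (UnitaryGroup.norm_embedding_eq_one_of_complexConj_mul_self L e₁ h₁ w)⟩ : Circle), ⟨w.1.embedding e₂, mem_sphere_zero_iff_norm.mpr (UnitaryGroup.norm_embedding_eq_one_of_complexConj_mul_self L e₂ h₂ w)⟩, ⟨w.1.embedding e₁, mem_sphere_zero_iff_norm.mpr (UnitaryGroup.norm_embedding_eq_one_of_complexConj_mul_self L e₁ h₁ w)⟩])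

end Summit.HodgeConjecture.HodgeConjecture.Cruxes.H413.K2E4ExplicitArchSingularTransferSignedDefs

end
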